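import Summits.PneNP.PneNP.Theorems.SoloBlindStreamingData
import Summits.PneNP.PneNP.Theorems.SoloBlindStreamingMagnification
import Literature.Computability.Complexity.MapFstMachine
import HarnessLib

/-!
# THEOREM C: McKay–Murray–Williams Theorem 1.3 — the named fact `thm13` is a theorem

McKay, Murray and Williams [MMW19, Theorem 1.3]: if there is a time-constructible `s` such that
`MCSP[s(n)]` has no `poly(s(n))`-space one-pass streaming algorithm with `poly(s(n))` update time,
then `P ≠ NP`.  The tree records this as the named fact
`Literature.Computability.MetaComplexity.McKayMurrayWilliams2019.thm13`
(`∀ s, IsTimeConstructible s → StreamingLowerBound s → P ≠ NP`, over the uniform streaming class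
`USTREAM`).  This file proves it:

* `mmw19_thm13` (and `mmw19_thm13_fact : McKayMurrayWilliams2019.thm13`) — kernel-checked, no named
  fact consumed;
* `MCSPSize_mem_USTREAM_poly_of_P_eq_NP_tc`: `P = NP → IsTimeConstructible s →
  ∃ c, MCSP[s] ∈ USTREAM (s(log N)^c + c) (s(log N)^c + c)` (the contrapositive content);
* `pneNP_of_streamingLowerBound_tc`: `IsTimeConstructible s → StreamingLowerBound s → PneNP`.

## Proof

THEOREM B (`SoloBlindStreamingMagnification`) proved the same conclusion for size bounds computed
on codes in time `poly(n)` (`CodeFP unE natE s`).  A time-constructible `s` (in the tree's sense: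
`n ≤ s n` and some TM2 machine maps `1ⁿ` to `bin (s n)` within `c · s n + c` steps) need not be,
but the update-time budget of the streaming algorithm is `poly(s n)`, not `poly(n)`.  So the size
bound is treated as *data* (`SoloBlindStreamingData`): ONE goodness test reads `s n` off the
padding `1^(s n + 1)` of its instance (`exists_goodTestD`), the search-to-decision selector only
needs agreement with `Good s` at that padding (`exists_selectorAt`), and the first stage of the
update machine (`exists_initMachineTC`) is the composite
`u ↦ ⟨1ⁿ, u⟩` (on codes) `↦ ⟨bin (s n), u⟩` (the time-constructibility machine run on the first
field of the tape, `mapFstAux`, time `c · s n + c + O(|word|)`) `↦ ⟨ff, 1⁰, s n + 1, u⟩` (on codes).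
The generic loop-and-core machine `exists_updateMachine_of_init` and the generic assembly
`mem_USTREAM_poly_of_parts` of THEOREM B then apply verbatim.

References: D. M. McKay, C. D. Murray, R. R. Williams, *Weak lower bounds on resource-bounded
compression imply strong separations of complexity classes*, STOC 2019, Theorem 1.3 and §2;
S. Arora, B. Barak, *Computational Complexity: A Modern Approach*, 2009, §1.3 (running a machine
on one field of the tape; composition), Thm. 2.18 (search-to-decision under `P = NP`).
-/

namespace Summit.PneNP.PneNP.Theorems.SoloBlind

open Computability Polynomial
open Literature.Computability.Complexity Literature.Computability.Complexity.CircEval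
open Literature.Computability.Complexity.CodeFP (natE unE bitE pairE rawE strE unitE pairE_apply
  unE_eq_ones length_unE length_natE_le)
open Literature.Computability.MetaComplexity Literature.Computability.MetaComplexity.MCSPVerif
open Literature.Computability.MetaComplexity.McKayMurrayWilliams2019 (USTREAM StreamingLowerBound
  P_ne_NP_of_streamingLowerBound)

namespace CStream

/-! ### The first stage of the update machine for a time-constructible size bound -/

/-- **First stage for a time-constructible size bound.** If `n ≤ s n` and a TM2 machine maps `1ⁿ`
to `bin (s n)` within `c · s n + c` steps, then some machine maps the update input
`u = ⟨N, ⟨σ, b⟩⟩` to the initial loop word `⟨ff, 1⁰, s (log N) + 1, u⟩` within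
`p₁(s (log N) + |bin N| + |σ|)` steps for a fixed polynomial `p₁`: write `⟨1^(log N), u⟩`, run the
time-constructibility machine on the first field (`mapFstAux`), then write the loop word.
[cite: AroraBarak2009, §1.3 (subroutines on a designated part of the tape; composition)] -/
theorem exists_initMachineTC {s : ℕ → ℕ} (hs : ∀ n, n ≤ s n)
    (hsT : ∃ c : ℕ, TimeComputable unaryEncodeNat encodeNat s (fun n => c * s n + c)) :
    ∃ (M₁ : Turing.TM2ComputableAux Bool Bool) (p₁ : Polynomial ℕ),
      ∀ (N : ℕ) (σ : List Bool) (b : Bool), M₁.OutputsWithin (uE (N, σ, b))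
        (orbitB (s (Nat.log 2 N) + 1) (N, σ, b) 0)
        (p₁.eval (s (Nat.log 2 N) + (natE N).length + σ.length)) := by
  obtain ⟨c, Ms, hMs⟩ := hsT
  obtain ⟨pa, Ma, ha⟩ := cf_pre1.polyTimeComputable
  obtain ⟨pb, Mb, hb⟩ := cf_pre3.polyTimeComputable
  refine ⟨(Ma.comp (mapFstAux Ms)).comp Mb,
    pa.comp (2 * X + 5) + pb.comp (4 * X + 7) + (C (c + 11) * X + C (c + 20)), fun N σ b => ?_⟩
  set n := Nat.log 2 N with hn
  set m := s n with hm
  -- stage a: `u ↦ ⟨1ⁿ, u⟩`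
  have Ha : Ma.OutputsWithin (uE (N, σ, b)) (boolPair (unE n) (uE (N, σ, b)))
      (pa.eval (uE (N, σ, b)).length) := ha (N, σ, b)
  -- stage b: the time-constructibility machine on the first field
  have HT : Ms.OutputsWithin (unaryEncodeNat n) (encodeNat m) (c * m + c) := by
    have h := hMs n
    dsimp only at h
    rwa [show (unaryEncodeNat n).length = n from length_unE n] at h
  have Hb : (mapFstAux Ms).OutputsWithin (boolPair (unE n) (uE (N, σ, b)))
      (boolPair (natE m) (uE (N, σ, b)))
      (c * m + c + 3 * (natE m).length + 2 * (boolPair (unE n) (uE (N, σ, b))).length + 6) := by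
    have h := outputsWithin_mapFstAux Ms (z := boolPair (unE n) (uE (N, σ, b)))
      (out := encodeNat m) (m := c * m + c) (by rw [boolUnpair_boolPair]; exact HT)
    rwa [readRest_boolPair] at h
  -- stage c: `⟨m, u⟩ ↦ ⟨ff, 1⁰, m + 1, u⟩`
  have Hc : Mb.OutputsWithin (boolPair (natE m) (uE (N, σ, b))) (orbitB (m + 1) (N, σ, b) 0)
      (pb.eval (boolPair (natE m) (uE (N, σ, b))).length) := hb (m, (N, σ, b))
  have H := Turing.TM2ComputableAux.comp_outputsWithin _ _
    (Turing.TM2ComputableAux.comp_outputsWithin _ _ Ha Hb) Hc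
  refine H.mono ?_
  -- the time bound
  set A := m + (natE N).length + σ.length with hA
  have hL : (uE (N, σ, b)).length = 2 * (natE N).length + 2 * σ.length + 5 := length_uE N σ b
  have hnm : n ≤ m := hs n
  have hz : (boolPair (unE n) (uE (N, σ, b))).length ≤ 4 * A + 7 := by
    rw [length_boolPair, length_unE]; omega
  have hnat : (natE m).length ≤ m := length_natE_le m
  have hv : (boolPair (natE m) (uE (N, σ, b))).length ≤ 4 * A + 7 := by
    rw [length_boolPair]; omega
  have e1 : pa.eval (uE (N, σ, b)).length ≤ pa.eval (2 * A + 5) :=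
    TM2Iter.eval_mono pa (by omega)
  have e2 : pb.eval (boolPair (natE m) (uE (N, σ, b))).length ≤ pb.eval (4 * A + 7) :=
    TM2Iter.eval_mono pb hv
  have e3 : c * m ≤ c * A := Nat.mul_le_mul_left c (by omega)
  have hq : (pa.comp (2 * X + 5) + pb.comp (4 * X + 7) + (C (c + 11) * X + C (c + 20)) :
      Polynomial ℕ).eval A
        = pa.eval (2 * A + 5) + pb.eval (4 * A + 7) + ((c + 11) * A + (c + 20)) := by
    simp [eval_comp, eval_mul, eval_add]
  rw [hq]
  generalize (boolPair (unE n) (uE (N, σ, b))).length = lz at hz ⊢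
  generalize (boolPair (natE m) (uE (N, σ, b))).length = lv at e2 ⊢
  generalize (natE m).length = ln at hnat ⊢
  generalize (uE (N, σ, b)).length = L at e1 ⊢
  nlinarith [e1, e2, e3, hz, hnat, hA]

/-! ### Assembly for time-constructible size bounds -/

/-- **Uniform streaming upper bound for `MCSP[s]` under `NP ⊆ P`, `s` time-constructible.**
If `NP ⊆ P` and `s` is time-constructible, then for some `c` the language `MCSP[s]` is decided by
a uniform one-pass streaming algorithm with `s(log N)^c + c` space and `s(log N)^c + c` update and
report time. [cite: McKayMurrayWilliams2019, Thm. 1.3 (contrapositive direction of the proof)] -/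
theorem mem_USTREAM_poly_of_NP_subset_P_tc {s : ℕ → ℕ}
    (hNP : Nondeterministic.NP ⊆ Classes.P) (hsT : IsTimeConstructible s) :
    ∃ c : ℕ, MCSPSize s ∈ USTREAM (fun N => s (Nat.log 2 N) ^ c + c)
      (fun N => s (Nat.log 2 N) ^ c + c) := by
  obtain ⟨hs, hc⟩ := hsT
  obtain ⟨G, hGc, hGeq⟩ := exists_goodTestD hNP
  obtain ⟨g, hg, hsel⟩ := exists_selectorAt hNP hs hGc (P := fun N => s (Nat.log 2 N) + 1)
    (hGeq s) (fun N => Nat.le_succ _)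
  exact mem_USTREAM_poly_of_parts hs (hGeq s) hsel
    (exists_updateMachine_of_init hGc hg (exists_initMachineTC hs hc))

end CStream

/-! ### THEOREM C -/

/-- **`P = NP` puts `MCSP[s]` into `USTREAM (poly s) (poly s)` for every time-constructible `s`.**
[cite: McKayMurrayWilliams2019, Thm. 1.3 (proof)] -/
theorem MCSPSize_mem_USTREAM_poly_of_P_eq_NP_tc (h : Classes.P = Nondeterministic.NP)
    {s : ℕ → ℕ} (hsT : IsTimeConstructible s) :
    ∃ c : ℕ, MCSPSize s ∈ USTREAM (fun N => s (Nat.log 2 N) ^ c + c)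
      (fun N => s (Nat.log 2 N) ^ c + c) :=
  CStream.mem_USTREAM_poly_of_NP_subset_P_tc (fun L hL => by rw [h]; exact hL) hsT

/-- **THEOREM C (McKay–Murray–Williams, Theorem 1.3).** For every time-constructible `s`: if for
every `c` the language `MCSP[s]` is not decided by a uniform one-pass streaming algorithm with
`s(log N)^c + c` space and `s(log N)^c + c` update/report time, then `P ≠ NP`.  Kernel-checked from
first principles in the tree's TM2 calculus; no named fact is consumed.
[cite: McKayMurrayWilliams2019, Thm. 1.3] -/
theorem mmw19_thm13 : ∀ s : ℕ → ℕ, IsTimeConstructible s → StreamingLowerBound s →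
    Classes.P ≠ Nondeterministic.NP := fun _ hsT hlb h => by
  obtain ⟨c, hc⟩ := MCSPSize_mem_USTREAM_poly_of_P_eq_NP_tc h hsT
  exact hlb c hc

/-- The tree's named fact `McKayMurrayWilliams2019.thm13` holds (it is literally `mmw19_thm13`).
[cite: McKayMurrayWilliams2019, Thm. 1.3] -/
theorem mmw19_thm13_fact : McKayMurrayWilliams2019.thm13 := mmw19_thm13

/-- `StreamingLowerBound s → P ≠ NP` for every time-constructible `s`, unconditionally (the
Literature lemma `P_ne_NP_of_streamingLowerBound` with its fact hypothesis discharged).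
[cite: McKayMurrayWilliams2019, Thm. 1.3] -/
theorem P_ne_NP_of_streamingLowerBound_tc {s : ℕ → ℕ} (hsT : IsTimeConstructible s)
    (hlb : StreamingLowerBound s) : Classes.P ≠ Nondeterministic.NP :=
  mmw19_thm13 _ hsT hlb

/-- **THEOREM C, summit form.** For every time-constructible `s`: a uniform one-pass streaming
lower bound for `MCSP[s]` against `poly(s)` space and `poly(s)` update time gives `PneNP`.
[cite: McKayMurrayWilliams2019, Thm. 1.3] -/
theorem pneNP_of_streamingLowerBound_tc {s : ℕ → ℕ} (hsT : IsTimeConstructible s)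
    (hlb : StreamingLowerBound s) : PneNP :=
  pneNP_iff_P_ne_NP.2 (P_ne_NP_of_streamingLowerBound_tc hsT hlb)

end Summit.PneNP.PneNP.Theorems.SoloBlind
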